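import Literature.Analysis.FluidPDE.SawtoothCascade
import HarnessLib

/-!
# Robust cone estimates for the pulse-pair Jacobians of the sawtooth cascade (slope floor `ρ`)

Analysis/FluidPDE support file (theorems only; no definitions, no named facts), continuing Part 7 of
`SawtoothCascade` (`SawtoothCascade.sawtooth_cone_step`, `itinJac_growth`: Elgindi–Liss–Mattingly's
uniform-hyperbolicity cone lemma for the EXACT pulse pair, slopes `r, s = ±1`). The Gaussian-rounded
sawtooth profile has `|U′| < 1` everywhere, so the exact signs never occur; the present file proves
the ROBUST version with a slope floor: for `γ > 0`, aperture `m > 0`, `0 ≤ ρ` with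
`m(m + 2) ≤ (mρ² − 1)γ²` and shear slopes `ρ ≤ |r|, |s| ≤ 1`,

* `SawtoothCascade.robust_cone_step` — `A(r, s) = pulseJac γ r s` maps the unstable cone
  `{γ|v₂| ≤ m|v₁|}` into itself and expands the first coordinate by `≥ ρ²γ² − 1 − m`;
* `SawtoothCascade.itinJac_growth_of_slope_floor` — for an itinerary `L` all of whose slope pairs
  satisfy the floor, the cocycle `itinJac γ L` keeps the cone and expands `|v₁|` by
  `≥ (ρ²γ² − 1 − m)^{|L|}` (induction, as `itinJac_growth`; the tree's lemma is the case `ρ = 1`).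

Statements and proofs from the cell ad-ideate-p2 (K1loc crux idea 'sequential-cone-partial-mixing',
HOME file `K1LocalisedCascade_RobustCone.lean`, LIT-ASK L9), landed verbatim up to naming (the
slope-floor hypothesis `IsSlopeList ρ L` is spelled out, no new definition).

## References

* T. M. Elgindi, K. Liss, J. C. Mattingly, *Optimal enhanced dissipation and mixing for a
  time-periodic, Lipschitz velocity field on 𝕋²*, arXiv:2304.05374, §1.2.2 (cones `C_u`, `C_s`,
  the cocycle `∇T^N = Π A_{jᵢ}`) and §3.1 Lemma 3.1 (uniform hyperbolicity for `α` large).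
  [ElgindiLissMattingly2025]
-/

open Matrix

noncomputable section

namespace Literature.Analysis.FluidPDE.SawtoothCascade

/-- **Robust one-step cone estimate.** For `γ > 0`, aperture `m > 0`, slope floor `ρ ≥ 0` with
`m(m + 2) ≤ (mρ² − 1)γ²`, shear slopes `ρ ≤ |r|, |s| ≤ 1` and `v` in the unstable cone
`γ|v₂| ≤ m|v₁|`: `A(r, s)v` stays in the cone and `|(A(r, s)v)₁| ≥ (ρ²γ² − 1 − m)|v₁|`
(the tree's `sawtooth_cone_step` is the case `|r| = |s| = 1`; here `|rs| ≥ ρ²` replaces `|rs| = 1`).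
[cite: ElgindiLissMattingly2025, §3.1 Lemma 3.1 (cone invariance and expansion, α large)] -/
theorem robust_cone_step {γ m ρ r s : ℝ} (hγ : 0 < γ) (hm : 0 < m) (hρ : 0 ≤ ρ)
    (hγm : m * (m + 2) ≤ (m * ρ ^ 2 - 1) * γ ^ 2) (hr : ρ ≤ |r|) (hr1 : |r| ≤ 1) (hs : ρ ≤ |s|)
    (hs1 : |s| ≤ 1) {v : Fin 2 → ℝ} (hv : InUnstableCone γ m v) :
    InUnstableCone γ m (pulseJac γ r s *ᵥ v) ∧
      (ρ ^ 2 * γ ^ 2 - 1 - m) * |v 0| ≤ |(pulseJac γ r s *ᵥ v) 0| := by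
  have hag : |γ| = γ := abs_of_pos hγ
  rw [pulseJac_mulVec]
  unfold InUnstableCone at hv ⊢
  set x := v 0
  set y := v 1
  set x' := (1 + r * s * γ ^ 2) * x + r * γ * y with hx'
  set y' := s * γ * x + y with hy'
  have hx0 : 0 ≤ |x| := abs_nonneg x
  have hy0 : 0 ≤ |y| := abs_nonneg y
  have hrs : ρ ^ 2 ≤ |r| * |s| := by nlinarith [abs_nonneg r, abs_nonneg s]
  have h1 : ρ ^ 2 * γ ^ 2 * |x| ≤ |x'| + |x| + γ * |y| := by
    have e : r * s * γ ^ 2 * x = x' - (x + r * γ * y) := by rw [hx']; ring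
    have h0 : |r * s * γ ^ 2 * x| ≤ |x'| + |x + r * γ * y| := by rw [e]; exact abs_sub _ _
    have h2 : |x + r * γ * y| ≤ |x| + γ * |y| := by
      calc |x + r * γ * y| ≤ |x| + |r * γ * y| := abs_add_le _ _
        _ = |x| + |r| * (γ * |y|) := by rw [abs_mul, abs_mul, hag]; ring
        _ ≤ |x| + 1 * (γ * |y|) := by gcongr
        _ = |x| + γ * |y| := by ring
    have h3 : |r * s * γ ^ 2 * x| = |r| * |s| * γ ^ 2 * |x| := by
      rw [abs_mul, abs_mul, abs_mul, abs_pow, hag]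
    have h4 : ρ ^ 2 * γ ^ 2 * |x| ≤ |r| * |s| * γ ^ 2 * |x| := by
      have : 0 ≤ γ ^ 2 * |x| := by positivity
      nlinarith
    linarith
  have h2 : |y'| ≤ γ * |x| + |y| := by
    calc |y'| ≤ |s * γ * x| + |y| := abs_add_le _ _
      _ = |s| * (γ * |x|) + |y| := by rw [abs_mul, abs_mul, hag]; ring
      _ ≤ 1 * (γ * |x|) + |y| := by gcongr
      _ = γ * |x| + |y| := by ring
  have goal1 : (ρ ^ 2 * γ ^ 2 - 1 - m) * |x| ≤ |x'| := by nlinarith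
  refine ⟨?_, by simpa using goal1⟩
  have h3 : γ * |y'| ≤ γ ^ 2 * |x| + m * |x| := by nlinarith
  have h4 : m * ((ρ ^ 2 * γ ^ 2 - 1 - m) * |x|) ≤ m * |x'| := mul_le_mul_of_nonneg_left goal1 hm.le
  have h5 : (m * (m + 2) - (m * ρ ^ 2 - 1) * γ ^ 2) * |x| ≤ 0 :=
    mul_nonpos_of_nonpos_of_nonneg (by linarith) hx0
  show γ * |y'| ≤ m * |x'|
  nlinarith

/-- Under the threshold `m(m + 2) ≤ (mρ² − 1)γ²` (`γ, m > 0`) the robust expansion factor is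
nonnegative: `0 ≤ ρ²γ² − 1 − m` (indeed `m(ρ²γ² − 1 − m) ≥ γ² + m > 0`). [folklore] -/
private theorem robust_cone_factor_nonneg {γ m ρ : ℝ} (hγ : 0 < γ) (hm : 0 < m)
    (hγm : m * (m + 2) ≤ (m * ρ ^ 2 - 1) * γ ^ 2) : 0 ≤ ρ ^ 2 * γ ^ 2 - 1 - m := by
  have hγ2 : 0 < γ ^ 2 := by positivity
  have h1 : γ ^ 2 + m ≤ m * (ρ ^ 2 * γ ^ 2 - 1 - m) := by nlinarith
  by_contra h
  have h' : ρ ^ 2 * γ ^ 2 - 1 - m < 0 := lt_of_not_ge h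
  nlinarith [mul_pos_of_neg_of_neg (neg_neg_of_pos hm) h']

/-- **Robust itinerary growth** (ELM's Lemma 3.1 with a slope floor). For `γ > 0`, `m > 0`, `ρ ≥ 0`
with `m(m + 2) ≤ (mρ² − 1)γ²` and an itinerary `L` of slope pairs with `ρ ≤ |rᵢ|, |sᵢ| ≤ 1`, the
cocycle `itinJac γ L = Π A(rᵢ, sᵢ)` keeps the unstable cone and
`(ρ²γ² − 1 − m)^{|L|} |v₁| ≤ |(itinJac γ L · v)₁|` (the tree's `itinJac_growth` is the case of exact
signs `±1`). [cite: ElgindiLissMattingly2025, §3.1 Lemma 3.1 and §1.2.2 (∇T^N = Π A_{jᵢ})] -/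
theorem itinJac_growth_of_slope_floor {γ m ρ : ℝ} (hγ : 0 < γ) (hm : 0 < m) (hρ : 0 ≤ ρ)
    (hγm : m * (m + 2) ≤ (m * ρ ^ 2 - 1) * γ ^ 2) {L : List (ℝ × ℝ)}
    (hL : ∀ p ∈ L, ρ ≤ |p.1| ∧ |p.1| ≤ 1 ∧ ρ ≤ |p.2| ∧ |p.2| ≤ 1) {v : Fin 2 → ℝ}
    (hv : InUnstableCone γ m v) :
    InUnstableCone γ m (itinJac γ L *ᵥ v) ∧
      (ρ ^ 2 * γ ^ 2 - 1 - m) ^ L.length * |v 0| ≤ |(itinJac γ L *ᵥ v) 0| := by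
  have hc : 0 ≤ ρ ^ 2 * γ ^ 2 - 1 - m := robust_cone_factor_nonneg hγ hm hγm
  induction L with
  | nil => simpa [itinJac] using hv
  | cons p L ih =>
    have hL' : ∀ q ∈ L, ρ ≤ |q.1| ∧ |q.1| ≤ 1 ∧ ρ ≤ |q.2| ∧ |q.2| ≤ 1 :=
      fun q hq => hL q (List.mem_cons_of_mem _ hq)
    obtain ⟨ihc, ihg⟩ := ih hL'
    obtain ⟨hr, hr1, hs, hs1⟩ := hL p List.mem_cons_self
    have step := robust_cone_step hγ hm hρ hγm hr hr1 hs hs1 ihc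
    rw [itinJac, ← Matrix.mulVec_mulVec]
    refine ⟨step.1, ?_⟩
    calc (ρ ^ 2 * γ ^ 2 - 1 - m) ^ (p :: L).length * |v 0|
        = (ρ ^ 2 * γ ^ 2 - 1 - m) * ((ρ ^ 2 * γ ^ 2 - 1 - m) ^ L.length * |v 0|) := by
          rw [List.length_cons, pow_succ]; ring
      _ ≤ (ρ ^ 2 * γ ^ 2 - 1 - m) * |(itinJac γ L *ᵥ v) 0| := mul_le_mul_of_nonneg_left ihg hc
      _ ≤ |(pulseJac γ p.1 p.2 *ᵥ (itinJac γ L *ᵥ v)) 0| := step.2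

end Literature.Analysis.FluidPDE.SawtoothCascade

end
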